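import Summits.HodgeConjecture.HodgeConjecture.Theorems.Ring2WeilCoverageWeilGramLevel32SqrtNegOne
import Summits.HodgeConjecture.HodgeConjecture.Theorems.Ring2WeilCoverageWeilGramLevel32SqrtNegTwo
import Summits.HodgeConjecture.HodgeConjecture.Theorems.Ring2WeilCoverageWeilGramSign
import Summits.HodgeConjecture.HodgeConjecture.Theorems.Ring2WeilCoverageCyclotomicSignaturesLevel32
import HarnessLib

/-!
# Weil-type family coverage — THE COMPONENTS OF THE WEIL-TYPE `ℤ[ζ₃₂]`-EIGHTFOLDS, IV: `θ^i` (`i < 8`) is a `ℚ`-basis of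
# `ℚ(ζ₃₂)⁺`; for each of the 2 imaginary quadratic `K_d ⊂ ℚ(ζ₃₂)` EVERY principal-type `E_ζ′` has the Gram determinant
# of §1 of parts 156–157 (`ℚ(i)`: `128`; `ℚ(√−2)`: `2048`) — all of the RIGHT sign and in the SPLIT class:
# **the principally polarised Weil-type `ℤ[ζ₃₂]`-CM eightfolds lie on the SPLIT rows `W8.d.1`, for every `K_d`-balanced CM type**

research route conditional on HC_CM; not a corollary; Q11.4-sentence-2 already refuted in dim ≥ 3.

Ring 2, WEIL-TYPE FAMILY-COVERAGE CENSUS (`HOME/WEIL-FAMILY-COVERAGE.md` `## b01`, blocks b01.36 (D) (the YES rows at `32`),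
b01.47–b01.49; owner ring2-b01), part 158 of the `Ring2WeilCoverage*` series; continues parts 156–157 (traces,
Hankel matrices, determinants).
At the level `M = 32` (`g = 8`, `h(ℚ(ζ₃₂)) = 1`) EVERY census row `(32, K_d)` is a YES row (an `ι`-compatible
PRINCIPAL polarisation exists on every `K_d`-balanced `ℂ^Φ/Φ(ℤ[ζ₃₂])`, b01.36 / parts 14–22); this series computes, for each
`K_d ⊂ ℚ(ζ₃₂)`, van Geemen's Gram determinant of the principal type in the real frame `θ^i` and places these CM points on
their component: the SPLIT row `W8.d.1` — completing the census's component column at every `h = 1` level (b01.47–b01.49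
did `15, 16, 20, 24 / 21, 28, 36 / 33, 44 / 35, 45`).

* §2 `[ℚ(ζ₃₂)⁺ : ℚ] = 8` and **`1, θ, …, θ⁷` is a `ℚ`-basis of `ℚ(ζ₃₂)⁺`** (a relation traced against `ξ s θ^m` lies in
  the kernel of the non-singular Gram matrix).
* `K_d = ℚ(i)` (`s = √−1 = ζ⁸ = i`): **EVERY principal-type `ζ′` gives `det a = 128`** up to the sign `N(u) = ±1`, fixed to `+` by `Φ`-positivity (part 92); such `Φ`-positive `ζ′` exist on every `ℚ(i)`-balanced `Φ` (`exists_principal_thirtyTwo_sqrt_neg_one`) — CENSUS FORM; class **`[128] = [8² + 1·8²] = splitDiscriminantClass 4 1`**, SPLIT: row W8.1.1 `= (4, ℚ(i), 1)`.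
* `K_d = ℚ(√−2)` (`s = √−2 = ζ⁴ + ζ¹² = ζ₈ + ζ₈³`): **EVERY principal-type `ζ′` gives `det a = 2048`** up to the sign `N(u) = ±1`, fixed to `+` by `Φ`-positivity (part 92); such `Φ`-positive `ζ′` exist on every `ℚ(√−2)`-balanced `Φ` (`exists_principal_thirtyTwo_sqrt_neg_two`) — CENSUS FORM; class **`[2048] = [0² + 2·32²] = splitDiscriminantClass 4 2`**, SPLIT: row W8.2.1 `= (4, ℚ(√−2), 1)`.

HONEST FRAMING as parts 82–154: kernel statements about traces in `ℚ(ζ₃₂)`, Shimura's divisors of principal type on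
`ℂ^Φ/Φ(ℤ[ζ₃₂])` and norm classes; the census ROW words are the reading of the class `[det a]` by [vG94 Lemma 5.2 (3),
(5.4.1)]; nothing about Hodge classes, `W_K`, general members or HC; `HC_CM` is used nowhere.  No `def`, no named fact,
no `sorry`.

References: [cite: vanGeemen1994HodgeAV, Lemma 5.2 (2)–(4), 5.4 and (5.4.1)]; [cite: Shimura1998, §14.3 Prop. 4–5,
pp. 103–104]; census b01.36 (D), b01.47–b01.49 (seat-derived).
-/

noncomputable section

open Polynomial NumberField Module
open scoped nonZeroDivisors

namespace Summit.HodgeConjecture.Ring2WeilCoverage.WeilGramLevel32Principal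

open Literature.AlgebraicGeometry.VanGeemen1994 (weilField weilNormResidueGroup)
open Literature.AlgebraicGeometry.Motives (CMType normUnitsSubgroup)
open Literature.NumberTheory.ComplexMultiplication
open Summit.HodgeConjecture.Ring2WeilCoverage.WeilGramTools
open Summit.HodgeConjecture.Ring2WeilCoverage.WeilGramCMPoint
open Summit.HodgeConjecture.Ring2WeilCoverage.RealUnitNormHalfSystems (complexConj_eq_inv)
open Summit.HodgeConjecture.Ring2WeilCoverage.CyclotomicPrincipalObstruction (complexConj_xi)
open Summit.HodgeConjecture.Ring2WeilCoverage.CyclotomicDifferent (isOfType_one_xi_top xi_ne_zero)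
open Summit.HodgeConjecture.HodgeConjecture.Ring2.WeilCoverage (mk_neg_eq_split_of_odd mk_neg_ne_split_of_odd
  mk_eq_split_of_even mk_ne_split_of_even mem_normUnitsSubgroup_of_sq_add_mul_sq natCast_not_mem_normUnitsSubgroup_of_ramified)
open Summit.HodgeConjecture.HodgeConjecture.Ring2.Hypotheses (splitDiscriminantClass)
open Summit.HodgeConjecture.Ring2WeilCoverage.WeilGramLevel32
open Summit.HodgeConjecture.Ring2WeilCoverage.WeilGramLevel32SqrtNegOne
open Summit.HodgeConjecture.Ring2WeilCoverage.WeilGramLevel32SqrtNegTwo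
open Summit.HodgeConjecture.Ring2WeilCoverage.WeilGramSign (not_pos_of_neg_one_pow_mul_det_nonpos neg_one_pow_mul_det_realPart_pos)
open Summit.HodgeConjecture.Ring2WeilCoverage.CyclotomicSignaturesLevel32 (exists_principal_thirtyTwo_sqrt_neg_one exists_principal_thirtyTwo_sqrt_neg_two)
variable {K : Type} [Field K] [NumberField K] {ζ : K}

/-- `𝐞(t) = exp(2πi t/n) ∈ ℂ` (`ZMod.toCircle`). -/
local notation3 (prettyPrint := false) "𝐞 " t:max => ((ZMod.toCircle t : Circle) : ℂ)

/-- the residue set `S_Φ` read at level `32`. -/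
local notation3 (prettyPrint := false) "SΦ[" Φ "," z "]" =>
  (Finset.univ.filter fun t : ZMod 32 => ∃ σ ∈ (Φ : CMType K).1, σ (z : K) = 𝐞 t)

/-! ### §2 `1, θ, …, θ⁷` is a `ℚ`-basis of `K⁺ = ℚ(ζ₃₂)⁺` -/

/-- `[ℚ(ζ_32)⁺ : ℚ] = 8`. [folklore] -/
theorem finrank_realSubfield [IsCyclotomicExtension {32} ℚ K] [IsCMField K] :
    finrank ℚ (maximalRealSubfield K) = 8 := by
  have h1 : finrank ℚ K = 16 := by
    rw [IsCyclotomicExtension.finrank K (cyclotomic.irreducible_rat (by norm_num : 0 < 32))]; decide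
  have h2 := Module.finrank_mul_finrank ℚ (maximalRealSubfield K) K
  rw [Algebra.IsQuadraticExtension.finrank_eq_two (maximalRealSubfield K) K, h1] at h2
  omega

/-- **`1, θ, …, θ^{8−1}` are `ℚ`-linearly independent in `K⁺`**: a relation `Σ cₖ θ^k = 0`, multiplied by `ζ′ s θ^m` and
traced, says that `c` is in the kernel of the Gram matrix `a` of §1, whose determinant is non-zero.
research route conditional on HC_CM; not a corollary; Q11.4-sentence-2 already refuted in dim ≥ 3. [folklore] -/
theorem linearIndependent_thetaPow [IsCyclotomicExtension {32} ℚ K] [IsCMField K] (hζ : IsPrimitiveRoot ζ 32)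
    {ω : Fin 8 → maximalRealSubfield K} (hω : ∀ i, (ω i : K) = (ζ + ζ⁻¹) ^ (i : ℕ)) : LinearIndependent ℚ ω := by
  rw [Fintype.linearIndependent_iff]
  intro c hc
  have hcK : ∑ i : Fin 8, (c i : K) * (ζ + ζ⁻¹) ^ (i : ℕ) = 0 := by
    have h := congrArg (fun y : maximalRealSubfield K => (y : K)) hc
    simp only [ZeroMemClass.coe_zero] at h
    rw [← h]
    push_cast
    refine Finset.sum_congr rfl fun i _ => ?_
    rw [Rat.smul_def, hω i]
  have E : ∀ m : ℕ, ∑ i : Fin 8, c i * Algebra.trace ℚ K ((ζ ^ 7 * (aeval ζ (derivative (cyclotomic 32 ℚ)))⁻¹) * (ζ ^ 8) *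
      ((ζ + ζ⁻¹) ^ m * (ζ + ζ⁻¹) ^ (i : ℕ))) = 0 := by
    intro m
    have h := congrArg (fun y => Algebra.trace ℚ K ((ζ ^ 7 * (aeval ζ (derivative (cyclotomic 32 ℚ)))⁻¹) * (ζ ^ 8) * (ζ + ζ⁻¹) ^ m * y)) hcK
    simp only [mul_zero, map_zero, Finset.mul_sum, map_sum] at h
    rw [← h]
    refine Finset.sum_congr rfl fun i _ => ?_
    rw [show (ζ ^ 7 * (aeval ζ (derivative (cyclotomic 32 ℚ)))⁻¹) * (ζ ^ 8) * (ζ + ζ⁻¹) ^ m *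
        ((c i : K) * (ζ + ζ⁻¹) ^ (i : ℕ)) = (c i) • ((ζ ^ 7 * (aeval ζ (derivative (cyclotomic 32 ℚ)))⁻¹) * (ζ ^ 8) *
        ((ζ + ζ⁻¹) ^ m * (ζ + ζ⁻¹) ^ (i : ℕ))) by rw [Rat.smul_def]; ring, map_smul, smul_eq_mul]
  set x : Fin 8 → K := fun i => (ζ + ζ⁻¹) ^ (i : ℕ) with hxdef
  have hx : ∀ i, x i = (ζ + ζ⁻¹) ^ (i : ℕ) := fun i => rfl
  set a : Matrix (Fin 8) (Fin 8) ℚ := Matrix.of fun i j => Algebra.trace ℚ K ((ζ ^ 7 * (aeval ζ (derivative (cyclotomic 32 ℚ)))⁻¹) * x i *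
      IsCMField.complexConj K ((ζ ^ 8) * x j)) with hadef
  have ha : ∀ i j, a i j = Algebra.trace ℚ K ((ζ ^ 7 * (aeval ζ (derivative (cyclotomic 32 ℚ)))⁻¹) * x i *
      IsCMField.complexConj K ((ζ ^ 8) * x j)) := fun i j => rfl
  have hdet : a.det ≠ 0 := by
    rw [det_realPart_xi_sqrtNegOne hζ hx ha]; norm_num
  have ha2 : ∀ i j, a i j = -Algebra.trace ℚ K ((ζ ^ 7 * (aeval ζ (derivative (cyclotomic 32 ℚ)))⁻¹) * (ζ ^ 8) * (x i * x j)) :=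
    fun i j => by
      have h := congrFun (congrFun (ha_eq (complexConj_sqrtNegOne hζ) (complexConj_thetaFrame hζ hx) ha) i) j
      rwa [Matrix.of_apply] at h
  have hmv : a.mulVec (fun i => c i) = 0 := by
    funext m
    simp only [Matrix.mulVec, dotProduct, Pi.zero_apply, ha2, hx, neg_mul]
    rw [Finset.sum_neg_distrib, neg_eq_zero, ← E m]
    exact Finset.sum_congr rfl fun i _ => mul_comm _ _
  have h0 := Matrix.eq_zero_of_mulVec_eq_zero hdet hmv
  intro i
  simpa using congrFun h0 i

/-- **A `ℚ`-basis `ωb` of `K⁺ = ℚ(ζ_32)⁺` with `ωb i = θ^i`** (`i < 8`). [folklore] -/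
theorem exists_basis_thetaPow [IsCyclotomicExtension {32} ℚ K] [IsCMField K] (hζ : IsPrimitiveRoot ζ 32) :
    ∃ ωb : Basis (Fin 8) ℚ (maximalRealSubfield K), ∀ i, (ωb i : K) = (ζ + ζ⁻¹) ^ (i : ℕ) := by
  let θ' : maximalRealSubfield K :=
    ⟨ζ + ζ⁻¹, (IsCMField.complexConj_eq_self_iff K (ζ + ζ⁻¹)).mp (complexConj_theta hζ)⟩
  let ω : Fin 8 → maximalRealSubfield K := fun i => θ' ^ (i : ℕ)
  have hω : ∀ i, (ω i : K) = (ζ + ζ⁻¹) ^ (i : ℕ) := fun i => by simp [ω, θ']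
  have hli := linearIndependent_thetaPow hζ hω
  have hcard : Fintype.card (Fin 8) = finrank ℚ (maximalRealSubfield K) := by
    rw [Fintype.card_fin, finrank_realSubfield]
  exact ⟨basisOfLinearIndependentOfCardEqFinrank hli hcard, fun i => by
    rw [coe_basisOfLinearIndependentOfCardEqFinrank]; exact hω i⟩

/-! ### §3 `K_d = ℚ(i)` (`s = i`): invariance, census form, class SPLIT (row W8.1.1) -/

/-- **At level `32` (where `ℤ[ζ₃₂]⁺` HAS units of norm `−1` — every sign pattern is a unit's, part 22), every skew
`ζ′` of PRINCIPAL type on `ℤ[ζ₃₂]` (`IsOfType 1 ζ′ ⊤`; `ζ′ = uξ`, `u` a real unit) has Gram determinant `N(u)·128 = ±128`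
against `i` in the frame `θ^i` (`i < 8`)** (part 82 `det_realPart_mul` + `NumberField.Units.norm`); the sign is fixed by
`Φ`-positivity below.
research route conditional on HC_CM; not a corollary; Q11.4-sentence-2 already refuted in dim ≥ 3. [cite: vanGeemen1994HodgeAV, Lemma 5.2 (3)] [cite: Shimura1998, §14.3 Prop. 5, p. 104] -/
theorem det_realPart_principal_sqrtNegOne_or [IsCyclotomicExtension {32} ℚ K] [IsCMField K]
    (hζ : IsPrimitiveRoot ζ 32) {ζ' : K} (hζ' : IsCMField.complexConj K ζ' = -ζ')
    (hT : CMTypeLattice.IsOfType (1 : (FractionalIdeal (𝓞 K)⁰ K)ˣ) ζ' ⊤)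
    {x : Fin 8 → K} (hx : ∀ i, x i = (ζ + ζ⁻¹) ^ (i : ℕ)) {a : Matrix (Fin 8) (Fin 8) ℚ}
    (ha : ∀ i j, a i j = Algebra.trace ℚ K (ζ' * x i * IsCMField.complexConj K ((ζ ^ 8) * x j))) :
    a.det = 128 ∨ a.det = -128 := by
  obtain ⟨ωb, hωb⟩ := exists_basis_thetaPow hζ
  have hx' : ∀ i, x i = (ωb i : K) := fun i => (hx i).trans (hωb i).symm
  obtain ⟨γ₀, hγ⟩ := exists_real_eq_mul_of_skew (complexConj_xi_thirtyTwo hζ) (complexConj_sqrtNegOne hζ)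
  obtain ⟨u, hu⟩ := exists_units_eq_mul_of_isOfType (complexConj_xi_thirtyTwo hζ) (xi_ne_zero hζ 7) hζ'
    (isOfType_one_xi_top hζ 7) hT
  have hD := det_realPart_xi_sqrtNegOne hζ hx (a := Matrix.of fun i j => Algebra.trace ℚ K
    ((ζ ^ 7 * (aeval ζ (derivative (cyclotomic 32 ℚ)))⁻¹) * x i * IsCMField.complexConj K ((ζ ^ 8) * x j)))
    (fun i j => rfl)
  have hmul := det_realPart_mul ωb (complexConj_sqrtNegOne hζ) hx' hγ
    (β₀ := ((u : 𝓞 (maximalRealSubfield K)) : maximalRealSubfield K))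
    (a := Matrix.of fun i j => Algebra.trace ℚ K
      ((ζ ^ 7 * (aeval ζ (derivative (cyclotomic 32 ℚ)))⁻¹) * x i * IsCMField.complexConj K ((ζ ^ 8) * x j)))
    (a' := a) (fun i j => rfl) (fun i j => by rw [ha, hu])
  rw [hD] at hmul
  have hn := NumberField.Units.norm (maximalRealSubfield K) u
  rcases abs_eq (by norm_num : (0 : ℚ) ≤ 1) |>.mp hn with h1 | h1
  · left; rw [hmul, h1]; norm_num
  · right; rw [hmul, h1]; norm_num

open scoped Classical in
/-- **`det a = +128` for a `Φ`-POSITIVE principal-type `ζ′` on a CM type `Φ` of `i`-signature `(4, 4)`** — van Geemen's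
sign `0 < (−1)⁴ det a` (part 92) excludes `−128`; such `ζ′` exist on every `ℚ(i)`-balanced `Φ` (`exists_principal_thirtyTwo_sqrt_neg_one`, part 22):
the principally polarised Weil-type `ℤ[ζ₃₂]`-eightfolds for `ℚ(i)` have `det H = 128`, the SPLIT row W8.1.1 `= (4, ℚ(i), 1)`.
research route conditional on HC_CM; not a corollary; Q11.4-sentence-2 already refuted in dim ≥ 3. [cite: vanGeemen1994HodgeAV, Lemma 5.2 (3)–(4) and (5.4.1)] [cite: Shimura1998, §14.3 Prop. 4–5, pp. 103–104] -/
theorem det_realPart_principal_pos_sqrtNegOne [IsCyclotomicExtension {32} ℚ K] [IsCMField K]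
    (hζ : IsPrimitiveRoot ζ 32) (Φ : CMType K)
    (hneg : (Finset.univ.filter fun φ : Φ.1 => (φ.1 (ζ ^ 8)).im < 0).card = 4)
    (hposc : (Finset.univ.filter fun φ : Φ.1 => 0 < (φ.1 (ζ ^ 8)).im).card = 4)
    {ζ' : K} (hζ' : IsCMField.complexConj K ζ' = -ζ') (hpos : ∀ φ : Φ.1, 0 < (φ.1 ζ').im)
    (hT : CMTypeLattice.IsOfType (1 : (FractionalIdeal (𝓞 K)⁰ K)ˣ) ζ' ⊤)
    {x : Fin 8 → K} (hx : ∀ i, x i = (ζ + ζ⁻¹) ^ (i : ℕ)) {a : Matrix (Fin 8) (Fin 8) ℚ}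
    (ha : ∀ i j, a i j = Algebra.trace ℚ K (ζ' * x i * IsCMField.complexConj K ((ζ ^ 8) * x j))) :
    a.det = 128 := by
  obtain ⟨ωb, hωb⟩ := exists_basis_thetaPow hζ
  have hx' : ∀ i, x i = (ωb i : K) := fun i => (hx i).trans (hωb i).symm
  have hs := complexConj_sqrtNegOne hζ
  have hs0 : ((ζ ^ 8) : K) ≠ 0 := fun h => by
    have h2 := sq_sqrtNegOne hζ
    rw [h] at h2
    norm_num at h2
  have hζ'0 : ζ' ≠ 0 := by
    obtain ⟨φ, -⟩ := Finset.card_pos.mp (by rw [hposc]; norm_num :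
      0 < (Finset.univ.filter fun φ : Φ.1 => 0 < (φ.1 (ζ ^ 8)).im).card)
    intro h0
    have := hpos φ
    rw [h0, map_zero, Complex.zero_im] at this
    exact lt_irrefl _ this
  obtain ⟨γ₀, hγ⟩ := exists_real_eq_mul_of_skew hζ' hs
  have hsign := neg_one_pow_mul_det_realPart_pos Φ ωb hζ' hs hs0 hζ'0 hpos hneg hposc hx' hγ ha
  rcases det_realPart_principal_sqrtNegOne_or hζ hζ' hT hx ha with h | h
  · exact h
  · rw [h] at hsign; norm_num at hsign

open scoped Classical in
/-- **CENSUS FORM** (the YES row `(32, ℚ(i))`: existence in the tree + the determinant here): for every CM type `Φ` of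
`ℚ(ζ_32)` balanced for `N_K = {3, 7, 11, 15, 19, 23, 27, 31}` (`i`-signature `(4, 4)`), `ℂ^Φ/Φ(ℤ[ζ_32])` carries a `Φ`-positive divisor of
PRINCIPAL type, and EVERY such divisor has van Geemen Gram determinant `128` in the real frame `θ^i`: the SPLIT row W8.1.1 `= (4, ℚ(i), 1)`.
research route conditional on HC_CM; not a corollary; Q11.4-sentence-2 already refuted in dim ≥ 3. [cite: vanGeemen1994HodgeAV, Lemma 5.2 (3)–(4) and (5.4.1)] [cite: Shimura1998, §14.3 Prop. 4–5, pp. 103–104] -/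
theorem exists_principal_sqrtNegOne_det [IsCyclotomicExtension {32} ℚ K] [IsCMField K]
    (hζ : IsPrimitiveRoot ζ 32) (Φ : CMType K)
    (hbal : 2 * (SΦ[Φ, ζ] ∩ ({3, 7, 11, 15, 19, 23, 27, 31} : Finset (ZMod 32))).card = (SΦ[Φ, ζ]).card)
    (hneg : (Finset.univ.filter fun φ : Φ.1 => (φ.1 (ζ ^ 8)).im < 0).card = 4)
    (hposc : (Finset.univ.filter fun φ : Φ.1 => 0 < (φ.1 (ζ ^ 8)).im).card = 4) :
    ∃ ζ' : K, IsCMField.complexConj K ζ' = -ζ' ∧ (∀ φ : Φ.1, 0 < (φ.1 ζ').im) ∧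
      CMTypeLattice.IsOfType (1 : (FractionalIdeal (𝓞 K)⁰ K)ˣ) ζ' ⊤ ∧
      ∀ (x : Fin 8 → K), (∀ i, x i = (ζ + ζ⁻¹) ^ (i : ℕ)) → ∀ a : Matrix (Fin 8) (Fin 8) ℚ,
        (∀ i j, a i j = Algebra.trace ℚ K (ζ' * x i * IsCMField.complexConj K ((ζ ^ 8) * x j))) →
        a.det = 128 := by
  obtain ⟨ζ', h1, h2, h3⟩ := exists_principal_thirtyTwo_sqrt_neg_one hζ Φ hbal
  exact ⟨ζ', h1, h2, h3, fun x hx a ha => det_realPart_principal_pos_sqrtNegOne hζ Φ hneg hposc h1 h2 h3 hx ha⟩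

/-- **`[128]` is the SPLIT class `splitDiscriminantClass 4 1` in `ℚˣ/Nm(ℚ(√−1)ˣ)`** (`128 = 8² + 1·8² ∈ Nm`; `n = 4` even):
the principally polarised Weil-type `ℤ[ζ₃₂]`-CM eightfolds for `ℚ(i)` lie on the SPLIT row for `ℚ(i)` at `g = 8` (census W8.1.1 `= (4, ℚ(i), 1)`) — b02.1 (F3) / b01.8 for these CM points, in the kernel.
research route conditional on HC_CM; not a corollary; Q11.4-sentence-2 already refuted in dim ≥ 3. [cite: vanGeemen1994HodgeAV, 5.4 and (5.4.1)] -/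
theorem mk0_det_principal_sqrtNegOne :
    (QuotientGroup.mk (Units.mk0 (128 : ℚ) (by norm_num)) : weilNormResidueGroup 1) = splitDiscriminantClass 4 1 :=
  mk_eq_split_of_even (by decide) (by norm_num : (128 : ℚ) ≠ 0)
    (mem_normUnitsSubgroup_of_sq_add_mul_sq _ (8 : ℚ) (8 : ℚ) (by norm_num))

/-! ### §4 `K_d = ℚ(√−2)` (`s = s₂`): invariance, census form, class SPLIT (row W8.2.1) -/

/-- **At level `32` (where `ℤ[ζ₃₂]⁺` HAS units of norm `−1` — every sign pattern is a unit's, part 22), every skew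
`ζ′` of PRINCIPAL type on `ℤ[ζ₃₂]` (`IsOfType 1 ζ′ ⊤`; `ζ′ = uξ`, `u` a real unit) has Gram determinant `N(u)·2048 = ±2048`
against `s₂` in the frame `θ^i` (`i < 8`)** (part 82 `det_realPart_mul` + `NumberField.Units.norm`); the sign is fixed by
`Φ`-positivity below.
research route conditional on HC_CM; not a corollary; Q11.4-sentence-2 already refuted in dim ≥ 3. [cite: vanGeemen1994HodgeAV, Lemma 5.2 (3)] [cite: Shimura1998, §14.3 Prop. 5, p. 104] -/
theorem det_realPart_principal_sqrtNegTwo_or [IsCyclotomicExtension {32} ℚ K] [IsCMField K]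
    (hζ : IsPrimitiveRoot ζ 32) {ζ' : K} (hζ' : IsCMField.complexConj K ζ' = -ζ')
    (hT : CMTypeLattice.IsOfType (1 : (FractionalIdeal (𝓞 K)⁰ K)ˣ) ζ' ⊤)
    {x : Fin 8 → K} (hx : ∀ i, x i = (ζ + ζ⁻¹) ^ (i : ℕ)) {a : Matrix (Fin 8) (Fin 8) ℚ}
    (ha : ∀ i j, a i j = Algebra.trace ℚ K (ζ' * x i * IsCMField.complexConj K ((ζ ^ 4 + ζ ^ 12) * x j))) :
    a.det = 2048 ∨ a.det = -2048 := by
  obtain ⟨ωb, hωb⟩ := exists_basis_thetaPow hζ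
  have hx' : ∀ i, x i = (ωb i : K) := fun i => (hx i).trans (hωb i).symm
  obtain ⟨γ₀, hγ⟩ := exists_real_eq_mul_of_skew (complexConj_xi_thirtyTwo hζ) (complexConj_sqrtNegTwo hζ)
  obtain ⟨u, hu⟩ := exists_units_eq_mul_of_isOfType (complexConj_xi_thirtyTwo hζ) (xi_ne_zero hζ 7) hζ'
    (isOfType_one_xi_top hζ 7) hT
  have hD := det_realPart_xi_sqrtNegTwo hζ hx (a := Matrix.of fun i j => Algebra.trace ℚ K
    ((ζ ^ 7 * (aeval ζ (derivative (cyclotomic 32 ℚ)))⁻¹) * x i * IsCMField.complexConj K ((ζ ^ 4 + ζ ^ 12) * x j)))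
    (fun i j => rfl)
  have hmul := det_realPart_mul ωb (complexConj_sqrtNegTwo hζ) hx' hγ
    (β₀ := ((u : 𝓞 (maximalRealSubfield K)) : maximalRealSubfield K))
    (a := Matrix.of fun i j => Algebra.trace ℚ K
      ((ζ ^ 7 * (aeval ζ (derivative (cyclotomic 32 ℚ)))⁻¹) * x i * IsCMField.complexConj K ((ζ ^ 4 + ζ ^ 12) * x j)))
    (a' := a) (fun i j => rfl) (fun i j => by rw [ha, hu])
  rw [hD] at hmul
  have hn := NumberField.Units.norm (maximalRealSubfield K) u
  rcases abs_eq (by norm_num : (0 : ℚ) ≤ 1) |>.mp hn with h1 | h1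
  · left; rw [hmul, h1]; norm_num
  · right; rw [hmul, h1]; norm_num

open scoped Classical in
/-- **`det a = +2048` for a `Φ`-POSITIVE principal-type `ζ′` on a CM type `Φ` of `s₂`-signature `(4, 4)`** — van Geemen's
sign `0 < (−1)⁴ det a` (part 92) excludes `−2048`; such `ζ′` exist on every `ℚ(√−2)`-balanced `Φ` (`exists_principal_thirtyTwo_sqrt_neg_two`, part 22):
the principally polarised Weil-type `ℤ[ζ₃₂]`-eightfolds for `ℚ(√−2)` have `det H = 2048`, the SPLIT row W8.2.1 `= (4, ℚ(√−2), 1)`.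
research route conditional on HC_CM; not a corollary; Q11.4-sentence-2 already refuted in dim ≥ 3. [cite: vanGeemen1994HodgeAV, Lemma 5.2 (3)–(4) and (5.4.1)] [cite: Shimura1998, §14.3 Prop. 4–5, pp. 103–104] -/
theorem det_realPart_principal_pos_sqrtNegTwo [IsCyclotomicExtension {32} ℚ K] [IsCMField K]
    (hζ : IsPrimitiveRoot ζ 32) (Φ : CMType K)
    (hneg : (Finset.univ.filter fun φ : Φ.1 => (φ.1 (ζ ^ 4 + ζ ^ 12)).im < 0).card = 4)
    (hposc : (Finset.univ.filter fun φ : Φ.1 => 0 < (φ.1 (ζ ^ 4 + ζ ^ 12)).im).card = 4)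
    {ζ' : K} (hζ' : IsCMField.complexConj K ζ' = -ζ') (hpos : ∀ φ : Φ.1, 0 < (φ.1 ζ').im)
    (hT : CMTypeLattice.IsOfType (1 : (FractionalIdeal (𝓞 K)⁰ K)ˣ) ζ' ⊤)
    {x : Fin 8 → K} (hx : ∀ i, x i = (ζ + ζ⁻¹) ^ (i : ℕ)) {a : Matrix (Fin 8) (Fin 8) ℚ}
    (ha : ∀ i j, a i j = Algebra.trace ℚ K (ζ' * x i * IsCMField.complexConj K ((ζ ^ 4 + ζ ^ 12) * x j))) :
    a.det = 2048 := by
  obtain ⟨ωb, hωb⟩ := exists_basis_thetaPow hζ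
  have hx' : ∀ i, x i = (ωb i : K) := fun i => (hx i).trans (hωb i).symm
  have hs := complexConj_sqrtNegTwo hζ
  have hs0 : ((ζ ^ 4 + ζ ^ 12) : K) ≠ 0 := fun h => by
    have h2 := sq_sqrtNegTwo hζ
    rw [h] at h2
    norm_num at h2
  have hζ'0 : ζ' ≠ 0 := by
    obtain ⟨φ, -⟩ := Finset.card_pos.mp (by rw [hposc]; norm_num :
      0 < (Finset.univ.filter fun φ : Φ.1 => 0 < (φ.1 (ζ ^ 4 + ζ ^ 12)).im).card)
    intro h0
    have := hpos φ
    rw [h0, map_zero, Complex.zero_im] at this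
    exact lt_irrefl _ this
  obtain ⟨γ₀, hγ⟩ := exists_real_eq_mul_of_skew hζ' hs
  have hsign := neg_one_pow_mul_det_realPart_pos Φ ωb hζ' hs hs0 hζ'0 hpos hneg hposc hx' hγ ha
  rcases det_realPart_principal_sqrtNegTwo_or hζ hζ' hT hx ha with h | h
  · exact h
  · rw [h] at hsign; norm_num at hsign

open scoped Classical in
/-- **CENSUS FORM** (the YES row `(32, ℚ(√−2))`: existence in the tree + the determinant here): for every CM type `Φ` of
`ℚ(ζ_32)` balanced for `N_K = {5, 7, 13, 15, 21, 23, 29, 31}` (`s₂`-signature `(4, 4)`), `ℂ^Φ/Φ(ℤ[ζ_32])` carries a `Φ`-positive divisor of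
PRINCIPAL type, and EVERY such divisor has van Geemen Gram determinant `2048` in the real frame `θ^i`: the SPLIT row W8.2.1 `= (4, ℚ(√−2), 1)`.
research route conditional on HC_CM; not a corollary; Q11.4-sentence-2 already refuted in dim ≥ 3. [cite: vanGeemen1994HodgeAV, Lemma 5.2 (3)–(4) and (5.4.1)] [cite: Shimura1998, §14.3 Prop. 4–5, pp. 103–104] -/
theorem exists_principal_sqrtNegTwo_det [IsCyclotomicExtension {32} ℚ K] [IsCMField K]
    (hζ : IsPrimitiveRoot ζ 32) (Φ : CMType K)
    (hbal : 2 * (SΦ[Φ, ζ] ∩ ({5, 7, 13, 15, 21, 23, 29, 31} : Finset (ZMod 32))).card = (SΦ[Φ, ζ]).card)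
    (hneg : (Finset.univ.filter fun φ : Φ.1 => (φ.1 (ζ ^ 4 + ζ ^ 12)).im < 0).card = 4)
    (hposc : (Finset.univ.filter fun φ : Φ.1 => 0 < (φ.1 (ζ ^ 4 + ζ ^ 12)).im).card = 4) :
    ∃ ζ' : K, IsCMField.complexConj K ζ' = -ζ' ∧ (∀ φ : Φ.1, 0 < (φ.1 ζ').im) ∧
      CMTypeLattice.IsOfType (1 : (FractionalIdeal (𝓞 K)⁰ K)ˣ) ζ' ⊤ ∧
      ∀ (x : Fin 8 → K), (∀ i, x i = (ζ + ζ⁻¹) ^ (i : ℕ)) → ∀ a : Matrix (Fin 8) (Fin 8) ℚ,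
        (∀ i j, a i j = Algebra.trace ℚ K (ζ' * x i * IsCMField.complexConj K ((ζ ^ 4 + ζ ^ 12) * x j))) →
        a.det = 2048 := by
  obtain ⟨ζ', h1, h2, h3⟩ := exists_principal_thirtyTwo_sqrt_neg_two hζ Φ hbal
  exact ⟨ζ', h1, h2, h3, fun x hx a ha => det_realPart_principal_pos_sqrtNegTwo hζ Φ hneg hposc h1 h2 h3 hx ha⟩

/-- **`[2048]` is the SPLIT class `splitDiscriminantClass 4 2` in `ℚˣ/Nm(ℚ(√−2)ˣ)`** (`2048 = 0² + 2·32² ∈ Nm`; `n = 4` even):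
the principally polarised Weil-type `ℤ[ζ₃₂]`-CM eightfolds for `ℚ(√−2)` lie on the SPLIT row for `ℚ(√−2)` at `g = 8` (census W8.2.1 `= (4, ℚ(√−2), 1)`) — b02.1 (F3) / b01.8 for these CM points, in the kernel.
research route conditional on HC_CM; not a corollary; Q11.4-sentence-2 already refuted in dim ≥ 3. [cite: vanGeemen1994HodgeAV, 5.4 and (5.4.1)] -/
theorem mk0_det_principal_sqrtNegTwo :
    (QuotientGroup.mk (Units.mk0 (2048 : ℚ) (by norm_num)) : weilNormResidueGroup 2) = splitDiscriminantClass 4 2 :=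
  mk_eq_split_of_even (by decide) (by norm_num : (2048 : ℚ) ≠ 0)
    (mem_normUnitsSubgroup_of_sq_add_mul_sq _ (0 : ℚ) (32 : ℚ) (by norm_num))

end Summit.HodgeConjecture.Ring2WeilCoverage.WeilGramLevel32Principal

end
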